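import Literature.Analysis.FluidPDE.CarlemanCalculusOpen
import Mathlib.Geometry.Manifold.PartitionOfUnity
import Mathlib.Topology.MetricSpace.Thickening
import HarnessLib

/-!
# The backward heat inequality in weak form: `‖v‖²` is a distributional subsolution

Analysis/FluidPDE support file (theorems only) for the discharge of the named fact
`Literature.Analysis.FluidPDE.Carleman.seregin_backwardHeat_sup_le_L2`
(`FluidPDE/BackwardHeatRegularity`: Seregin 2014, App. A.2, (A.2.18) — the local `L∞–L²`
estimate for functions satisfying the backward heat inequality
`|∂ₜv + Δv| ≤ c₁ (|∇v| + |v|)`, which Seregin quotes from the regularity theory of linear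
parabolic equations [Ladyženskaja–Solonnikov–Ural′ceva 1968]). The first step of the classical
proof of such estimates for the (constant-coefficient) heat operator is the observation that
`w = |v|²` is a **subsolution**: pointwise on the open set `U` where `v` is `C²`,

  `∂ₜ|v|² + Δ|v|² = 2⟪v, ∂ₜv + Δv⟫ + 2|∇v|² ≥ -(2c + c²/2) |v|²`,  `c = |c₁|`,

by Young's inequality `2c|v||∇v| ≤ c²|v|²/2 + 2|∇v|²`. This file proves the **weak (integrated)
form** of this inequality, which is what the duality argument of
`FluidPDE/BackwardHeatRegularityProofs` consumes: for every test function `G ≥ 0` of class `C²`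
with compact support inside `U`,

  `∫ (∂ₜG - ΔG - (2c + c²/2) G) |v|² ≤ 0`            (`integral_heatOp_mul_norm_sq_nonpos`),

all operators being the frame operators `∂ₜ = Carleman.dt`, `Δ = Carleman.lap`,
`|∇·|² = Carleman.gradSq` of `FluidPDE/CarlemanCalculus` on uncurried fields `ℝ × E → F`.

## Proof

* `exists_smooth_cutoff_nhdsSet`: a smooth `χ ∈ C_c^∞(U)` equal to `1` near the compact
  `tsupport G` (smooth Urysohn lemma, Mathlib's `exists_contMDiffMap_zero_one_nhds_of_isClosed`;
  twin of `Literature/Analysis/FunctionSpaces/MeyersSerrinProofs.exists_smooth_cutoff`, whose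
  import closure is foreign to this file).
* `integral_mul_inner_dt_add_lap` (the duality identity): for a global `C²` compactly supported
  field `W` and a `C²` weight `G`,
  `∫ G ⟪W, ∂ₜW + ΔW⟫ = -½ ∫ ∂ₜG |W|² + ½ ∫ ΔG |W|² - ∫ G |∇W|²`
  (square rule in `t`; Green's formula in `x` followed by the square rule with the weights `∂ᵢG`;
  the integration-by-parts lemmas of `FluidPDE/CarlemanCalculusOpen` on `Ω = univ`).
* `integral_heatOp_mul_norm_sq_nonpos_of_global`: if moreover `|∂ₜW + ΔW| ≤ c(|∇W| + |W|)`
  wherever `G ≠ 0` and `G ≥ 0`, the `|∇W|²` terms cancel and the weak inequality follows.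
* `integral_heatOp_mul_norm_sq_nonpos`: the local version for `v ∈ C²(U)`, applied to
  `W = χ • v`, which agrees with `v` together with all its derivatives near `tsupport G`.

## References

* G. Seregin, *Lecture notes on regularity theory for the Navier–Stokes equations*, World
  Scientific 2014, App. A.2, (A.2.18), p. 210 ("the regularity theory for linear parabolic
  equations give us …"). [Seregin2014]
* O. A. Ladyženskaja, V. A. Solonnikov, N. N. Ural′ceva, *Linear and quasi-linear equations of
  parabolic type*, AMS 1968, Ch. III §8 (local estimates via cut-offs and duality).
* G. M. Lieberman, *Second order parabolic differential equations*, World Scientific 1996,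
  Ch. VI §6 (local maximum principle for subsolutions).
-/

noncomputable section

open MeasureTheory Set Function Filter Topology
open scoped InnerProductSpace RealInnerProductSpace Manifold ContDiff

namespace Literature.Analysis.FluidPDE

namespace Carleman

/-! ### Smooth cut-offs equal to one near a compact set -/

section Cutoff

variable {X : Type*} [NormedAddCommGroup X] [NormedSpace ℝ X] [FiniteDimensional ℝ X]

/-- **Smooth cut-off functions**: for a compact `K` inside an open `U` of a finite-dimensional
real normed space there is `χ ∈ C_c^∞(U)` with `χ = 1` on a neighbourhood of `K` (smooth Urysohn
lemma: Mathlib's `exists_contMDiffMap_zero_one_nhds_of_isClosed` applied to `(K_δ)ᶜ` and `K`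
for a `δ`-neighbourhood `K_δ` of `K` with `K̄_δ ⊆ U`). Twin of
`MeyersSerrinProofs.exists_smooth_cutoff` (foreign import closure). [folklore] -/
theorem exists_smooth_cutoff_nhdsSet {K U : Set X} (hK : IsCompact K) (hU : IsOpen U)
    (hKU : K ⊆ U) :
    ∃ χ : X → ℝ, ContDiff ℝ (⊤ : ℕ∞) χ ∧ HasCompactSupport χ ∧ tsupport χ ⊆ U ∧
      ∀ᶠ x in 𝓝ˢ K, χ x = 1 := by
  obtain ⟨δ, hδ, hδU⟩ := hK.exists_cthickening_subset_open hU hKU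
  have hd : Disjoint (Metric.thickening δ K)ᶜ K :=
    disjoint_compl_left.mono_right (Metric.self_subset_thickening hδ K)
  obtain ⟨f, hf0, hf1, -⟩ :=
    exists_contMDiffMap_zero_one_nhds_of_isClosed (𝓘(ℝ, X)) (n := (⊤ : ℕ∞))
      Metric.isOpen_thickening.isClosed_compl hK.isClosed hd
  have hsupp : support (f : X → ℝ) ⊆ Metric.thickening δ K := fun x hx => by
    by_contra hx'
    exact hx (hf0.self_of_nhdsSet x hx')
  have htsupp : tsupport (f : X → ℝ) ⊆ Metric.cthickening δ K :=
    (closure_mono hsupp).trans (Metric.closure_thickening_subset_cthickening δ K)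
  exact ⟨f, contMDiff_iff_contDiff.1 f.contMDiff,
    hK.cthickening.of_isClosed_subset (isClosed_tsupport _) htsupp, htsupp.trans hδU, hf1⟩

end Cutoff

/-! ### The duality identity for global compactly supported fields -/

section Duality

variable {E : Type*} [NormedAddCommGroup E] [InnerProductSpace ℝ E] [FiniteDimensional ℝ E]
  [MeasurableSpace E] [BorelSpace E]
variable {F : Type*} [NormedAddCommGroup F] [InnerProductSpace ℝ F]

omit [FiniteDimensional ℝ E] [MeasurableSpace E] [BorelSpace E] in
/-- `∂ₑ` of a `C²` field is `C¹`. [folklore] -/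
theorem contDiff_one_dx_of_two {W : ℝ × E → F} (hW : ContDiff ℝ 2 W) (e : E) :
    ContDiff ℝ 1 (dx e W) :=
  (hW.fderiv_right (m := 1) le_rfl).clm_apply contDiff_const

omit [FiniteDimensional ℝ E] [MeasurableSpace E] [BorelSpace E] in
/-- `∂ₜ` of a `C²` field is `C¹`. [folklore] -/
theorem contDiff_one_dt_of_two {W : ℝ × E → F} (hW : ContDiff ℝ 2 W) :
    ContDiff ℝ 1 (dt W) :=
  (hW.fderiv_right (m := 1) le_rfl).clm_apply contDiff_const

omit [MeasurableSpace E] [BorelSpace E] in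
/-- `Δₓ` of a `C²` field is continuous. [folklore] -/
theorem continuous_lap_of_two {W : ℝ × E → F} (hW : ContDiff ℝ 2 W) : Continuous (lap W) := by
  unfold lap
  refine continuous_finsetSum _ fun i _ => ?_
  exact ((contDiff_one_dx_of_two hW _).continuous_fderiv one_ne_zero).clm_apply continuous_const

omit [MeasurableSpace E] [BorelSpace E] in
/-- `|∇ₓW|²` of a `C¹` field is continuous. [folklore] -/
theorem continuous_gradSq_of_one {W : ℝ × E → F} (hW : ContDiff ℝ 1 W) :
    Continuous (gradSq W) := by
  unfold gradSq
  refine continuous_finsetSum _ fun i _ => ?_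
  exact ((hW.continuous_fderiv one_ne_zero).clm_apply continuous_const).norm.pow 2

/-- **Green's formula followed by the square rule**, one coordinate:
`∫ G ⟪W, ∂ₑ∂ₑW⟫ = ½ ∫ ∂ₑ∂ₑG ‖W‖² - ∫ G ‖∂ₑW‖²` for `W ∈ C²_c`, `G ∈ C²`. [folklore] -/
theorem integral_mul_inner_dx_dx {W : ℝ × E → F} (hW : ContDiff ℝ 2 W)
    (hWc : HasCompactSupport W) {G : ℝ × E → ℝ} (hG : ContDiff ℝ 2 G) (e : E) :
    ∫ z, G z * ⟪W z, dx e (dx e W) z⟫ =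
      (1 / 2) * (∫ z, fderiv ℝ (fun y => fderiv ℝ G y (0, e)) z (0, e) * ‖W z‖ ^ 2)
        - ∫ z, G z * ‖dx e W z‖ ^ 2 := by
  have hW1 : ContDiff ℝ 1 W := hW.of_le one_le_two
  have hG1 : ContDiffOn ℝ 1 G univ := (hG.of_le one_le_two).contDiffOn
  have hdG1 : ContDiffOn ℝ 1 (fun y => fderiv ℝ G y (0, e)) univ :=
    ((hG.fderiv_right (m := 1) le_rfl).clm_apply contDiff_const).contDiffOn
  have h1 := integral_mul_inner_fderiv_eq_of_open isOpen_univ (w := G) (Φ := W)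
    (Ψ := dx e W) hG1 hW1 (contDiff_one_dx_of_two hW e) hWc (hasCompactSupport_dx hWc _)
    (subset_univ _) (0, e)
  have h2 := two_mul_integral_mul_inner_fderiv_self_of_open isOpen_univ
    (w := fun y => fderiv ℝ G y (0, e)) (W := W) hdG1 hW1 hWc (subset_univ _) (0, e)
  have e1 : ∫ z, G z * ⟪fderiv ℝ W z (0, e), dx e W z⟫ = ∫ z, G z * ‖dx e W z‖ ^ 2 :=
    integral_congr_ae (Eventually.of_forall fun z => by
      show G z * ⟪fderiv ℝ W z (0, e), dx e W z⟫ = G z * ‖dx e W z‖ ^ 2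
      rw [← dx_apply, real_inner_self_eq_norm_sq])
  have e2 : ∫ z, fderiv ℝ G z (0, e) * ⟪W z, dx e W z⟫ =
      ∫ z, fderiv ℝ G z (0, e) * ⟪W z, fderiv ℝ W z (0, e)⟫ := rfl
  have e3 : ∫ z, G z * ⟪W z, fderiv ℝ (dx e W) z (0, e)⟫ = ∫ z, G z * ⟪W z, dx e (dx e W) z⟫ :=
    rfl
  rw [e1, e2] at h1
  rw [← e3, h1]
  linarith

/-- Integrability of the weighted pairings `g ⟪W, X⟫` with `W` compactly supported and
everything continuous. [folklore] -/
theorem integrable_mul_inner_of_continuous {g : ℝ × E → ℝ} {W X : ℝ × E → F}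
    (hg : Continuous g) (hW : Continuous W) (hX : Continuous X) (hWc : HasCompactSupport W) :
    Integrable fun z => g z * ⟪W z, X z⟫ :=
  integrable_of_continuous_hasCompactSupport (hg.mul (hW.inner hX))
    (hasCompactSupport_mul_inner_left hWc)

omit [InnerProductSpace ℝ F] in
/-- Integrability of the weighted squares `g ‖W‖²` with `W` compactly supported and
everything continuous. [folklore] -/
theorem integrable_mul_norm_sq_of_continuous {g : ℝ × E → ℝ} {W : ℝ × E → F}
    (hg : Continuous g) (hW : Continuous W) (hWc : HasCompactSupport W) :
    Integrable fun z => g z * ‖W z‖ ^ 2 :=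
  integrable_of_continuous_hasCompactSupport (hg.mul (hW.norm.pow 2))
    (hasCompactSupport_mul_norm_sq hWc)

/-- **The duality identity.** For a `C²` compactly supported field `W : ℝ × E → F` and a `C²`
weight `G`,
`∫ G ⟪W, ∂ₜW + ΔₓW⟫ = -½ ∫ ∂ₜG ‖W‖² + ½ ∫ ΔₓG ‖W‖² - ∫ G |∇ₓW|²`
(all derivatives moved onto the weight; no boundary terms). This is the integration by parts
behind every duality proof of local estimates for the heat operator (LSU 1968, Ch. III §8). [folklore] -/
theorem integral_mul_inner_dt_add_lap {W : ℝ × E → F} (hW : ContDiff ℝ 2 W)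
    (hWc : HasCompactSupport W) {G : ℝ × E → ℝ} (hG : ContDiff ℝ 2 G) :
    ∫ z, G z * ⟪W z, dt W z + lap W z⟫ =
      -(1 / 2) * (∫ z, dt G z * ‖W z‖ ^ 2) + (1 / 2) * (∫ z, lap G z * ‖W z‖ ^ 2)
        - ∫ z, G z * gradSq W z := by
  set b := stdOrthonormalBasis ℝ E with hb
  have hW1 : ContDiff ℝ 1 W := hW.of_le one_le_two
  have hG1 : ContDiffOn ℝ 1 G univ := (hG.of_le one_le_two).contDiffOn
  have cG : Continuous G := hG.continuous
  have cW : Continuous W := hW.continuous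
  have cdtW : Continuous (dt W) := (contDiff_one_dt_of_two hW).continuous
  have cdxW : ∀ e, Continuous (dx e W) := fun e => (contDiff_one_dx_of_two hW e).continuous
  have cdxdxW : ∀ e, Continuous (dx e (dx e W)) := fun e =>
    ((contDiff_one_dx_of_two hW e).continuous_fderiv one_ne_zero).clm_apply continuous_const
  have cddG : ∀ e : E, Continuous fun z => fderiv ℝ (fun y => fderiv ℝ G y (0, e)) z (0, e) :=
    fun e => (((hG.fderiv_right (m := 1) le_rfl).clm_apply contDiff_const).continuous_fderiv
      one_ne_zero).clm_apply continuous_const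
  -- time part
  have ht := two_mul_integral_mul_inner_fderiv_self_of_open isOpen_univ (w := G) (W := W) hG1
    hW1 hWc (subset_univ _) ((1 : ℝ), (0 : E))
  have ht' : ∫ z, G z * ⟪W z, dt W z⟫ = -(1 / 2) * ∫ z, dt G z * ‖W z‖ ^ 2 := by
    have e1 : ∫ z, G z * ⟪W z, dt W z⟫ = ∫ z, G z * ⟪W z, fderiv ℝ W z (1, 0)⟫ := rfl
    have e2 : ∫ z, dt G z * ‖W z‖ ^ 2 = ∫ z, fderiv ℝ G z (1, 0) * ‖W z‖ ^ 2 := rfl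
    rw [e1, e2]
    linarith
  -- space part
  have hsp : ∫ z, G z * ⟪W z, lap W z⟫ =
      (1 / 2) * (∫ z, lap G z * ‖W z‖ ^ 2) - ∫ z, G z * gradSq W z := by
    have hint1 : ∀ i, Integrable fun z => G z * ⟪W z, dx (b i) (dx (b i) W) z⟫ := fun i =>
      integrable_mul_inner_of_continuous cG cW (cdxdxW _) hWc
    have hint2 : ∀ i, Integrable fun z =>
        fderiv ℝ (fun y => fderiv ℝ G y (0, b i)) z (0, b i) * ‖W z‖ ^ 2 := fun i =>
      integrable_mul_norm_sq_of_continuous (cddG _) cW hWc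
    have hint3 : ∀ i, Integrable fun z => G z * ‖dx (b i) W z‖ ^ 2 := fun i =>
      integrable_mul_norm_sq_of_continuous cG (cdxW _) (hasCompactSupport_dx hWc _)
    calc ∫ z, G z * ⟪W z, lap W z⟫
        = ∫ z, ∑ i, G z * ⟪W z, dx (b i) (dx (b i) W) z⟫ := by
          refine integral_congr_ae (Eventually.of_forall fun z => ?_)
          show G z * ⟪W z, lap W z⟫ = ∑ i, G z * ⟪W z, dx (b i) (dx (b i) W) z⟫
          rw [lap, ← Finset.mul_sum, ← inner_sum]
      _ = ∑ i, ∫ z, G z * ⟪W z, dx (b i) (dx (b i) W) z⟫ :=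
          integral_finsetSum _ fun i _ => hint1 i
      _ = ∑ i, ((1 / 2) * (∫ z, fderiv ℝ (fun y => fderiv ℝ G y (0, b i)) z (0, b i) * ‖W z‖ ^ 2)
            - ∫ z, G z * ‖dx (b i) W z‖ ^ 2) :=
          Finset.sum_congr rfl fun i _ => integral_mul_inner_dx_dx hW hWc hG (b i)
      _ = (1 / 2) * (∑ i, ∫ z, fderiv ℝ (fun y => fderiv ℝ G y (0, b i)) z (0, b i) * ‖W z‖ ^ 2)
            - ∑ i, ∫ z, G z * ‖dx (b i) W z‖ ^ 2 := by
          rw [Finset.sum_sub_distrib, Finset.mul_sum]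
      _ = (1 / 2) * (∫ z, lap G z * ‖W z‖ ^ 2) - ∫ z, G z * gradSq W z := by
          congr 2
          · rw [← integral_finsetSum _ fun i _ => hint2 i]
            refine integral_congr_ae (Eventually.of_forall fun z => ?_)
            show ∑ i, fderiv ℝ (fun y => fderiv ℝ G y (0, b i)) z (0, b i) * ‖W z‖ ^ 2 =
              lap G z * ‖W z‖ ^ 2
            rw [lap, Finset.sum_mul]
            rfl
          · rw [← integral_finsetSum _ fun i _ => hint3 i]
            refine integral_congr_ae (Eventually.of_forall fun z => ?_)
            show ∑ i, G z * ‖dx (b i) W z‖ ^ 2 = G z * gradSq W z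
            rw [gradSq, Finset.mul_sum]
  -- assemble
  have hadd : ∫ z, G z * ⟪W z, dt W z + lap W z⟫ =
      (∫ z, G z * ⟪W z, dt W z⟫) + ∫ z, G z * ⟪W z, lap W z⟫ := by
    rw [← integral_add (integrable_mul_inner_of_continuous cG cW cdtW hWc)
      (integrable_mul_inner_of_continuous cG cW (continuous_lap_of_two hW) hWc)]
    refine integral_congr_ae (Eventually.of_forall fun z => ?_)
    show G z * ⟪W z, dt W z + lap W z⟫ = G z * ⟪W z, dt W z⟫ + G z * ⟪W z, lap W z⟫
    rw [inner_add_right, mul_add]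
  rw [hadd, ht', hsp]
  ring

/-! ### The weak subsolution inequality -/

omit [MeasurableSpace E] [BorelSpace E] [InnerProductSpace ℝ F] in
/-- `|∇ₓW|²` vanishes off the support of `W`. [folklore] -/
theorem gradSq_eq_zero_of_notMem_tsupport {G' : Type*} [NormedAddCommGroup G']
    [NormedSpace ℝ G'] {W : ℝ × E → G'} {z : ℝ × E} (hz : z ∉ tsupport W) : gradSq W z = 0 := by
  unfold gradSq
  refine Finset.sum_eq_zero fun i _ => ?_
  rw [dx_apply, fderiv_of_notMem_tsupport (𝕜 := ℝ) hz]
  simp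

omit [MeasurableSpace E] [BorelSpace E] in
/-- **Young's inequality step.** If `|∂ₜW + ΔW| ≤ c (|∇W| + |W|)` at `z`, then
`⟪W, ∂ₜW + ΔW⟫ + |∇W|² ≥ -(c + c²/4) |W|²` there (any real `c`; for `c < 0` the hypothesis
forces `∂ₜW + ΔW = 0` or `W = ∇W = 0`). [folklore] -/
theorem inner_dt_add_lap_add_gradSq_ge {W : ℝ × E → F} {c : ℝ} {z : ℝ × E}
    (h : ‖dt W z + lap W z‖ ≤ c * (Real.sqrt (gradSq W z) + ‖W z‖)) :
    -(c + c ^ 2 / 4) * ‖W z‖ ^ 2 ≤ ⟪W z, dt W z + lap W z⟫ + gradSq W z := by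
  have hg0 : 0 ≤ gradSq W z := gradSq_nonneg W z
  set s := Real.sqrt (gradSq W z) with hs
  have hs0 : 0 ≤ s := Real.sqrt_nonneg _
  have hss : s ^ 2 = gradSq W z := Real.sq_sqrt hg0
  have h1 : -(‖W z‖ * (c * (s + ‖W z‖))) ≤ ⟪W z, dt W z + lap W z⟫ := by
    have hcs := abs_real_inner_le_norm (W z) (dt W z + lap W z)
    have hle : ‖W z‖ * ‖dt W z + lap W z‖ ≤ ‖W z‖ * (c * (s + ‖W z‖)) :=
      mul_le_mul_of_nonneg_left h (norm_nonneg _)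
    have := neg_abs_le ⟪W z, dt W z + lap W z⟫
    linarith
  have h2 : c * ‖W z‖ * s ≤ c ^ 2 * ‖W z‖ ^ 2 / 4 + s ^ 2 := by
    nlinarith [sq_nonneg (c * ‖W z‖ / 2 - s)]
  rw [← hss]
  nlinarith [norm_nonneg (W z)]

/-- **Weak subsolution inequality, global form.** Let `W : ℝ × E → F` be `C²` with compact
support, `G ≥ 0` a `C²` weight, `c` real, and suppose `|∂ₜW + ΔW| ≤ c (|∇W| + |W|)` wherever
`G ≠ 0`. Then `∫ (∂ₜG - ΔG - (2c + c²/2) G) ‖W‖² ≤ 0`: by the duality identity and the Young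
step the `|∇W|²` terms cancel exactly. [folklore] -/
theorem integral_heatOp_mul_norm_sq_nonpos_of_global {W : ℝ × E → F} (hW : ContDiff ℝ 2 W)
    (hWc : HasCompactSupport W) {G : ℝ × E → ℝ} (hG : ContDiff ℝ 2 G) (hG0 : ∀ z, 0 ≤ G z)
    {c : ℝ}
    (hineq : ∀ z, G z ≠ 0 → ‖dt W z + lap W z‖ ≤ c * (Real.sqrt (gradSq W z) + ‖W z‖)) :
    ∫ z, (dt G z - lap G z - (2 * c + c ^ 2 / 2) * G z) * ‖W z‖ ^ 2 ≤ 0 := by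
  have hW1 : ContDiff ℝ 1 W := hW.of_le one_le_two
  have cG : Continuous G := hG.continuous
  have cW : Continuous W := hW.continuous
  have cdtG : Continuous (dt G) := (contDiff_one_dt_of_two hG).continuous
  have clapG : Continuous (lap G) := continuous_lap_of_two hG
  have cdtW : Continuous (dt W) := (contDiff_one_dt_of_two hW).continuous
  have clapW : Continuous (lap W) := continuous_lap_of_two hW
  have cgW : Continuous (gradSq W) := continuous_gradSq_of_one hW1
  -- pointwise Young step, weighted by `G ≥ 0`
  have hpt : ∀ z, -(c + c ^ 2 / 4) * (G z * ‖W z‖ ^ 2) ≤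
      G z * ⟪W z, dt W z + lap W z⟫ + G z * gradSq W z := by
    intro z
    by_cases hz : G z = 0
    · simp [hz]
    · have h := inner_dt_add_lap_add_gradSq_ge (hineq z hz)
      have := mul_le_mul_of_nonneg_left h (hG0 z)
      nlinarith
  -- integrability
  have i1 : Integrable fun z => G z * ⟪W z, dt W z + lap W z⟫ :=
    integrable_mul_inner_of_continuous cG cW (cdtW.add clapW) hWc
  have i2 : Integrable fun z => G z * gradSq W z :=
    integrable_of_continuous_hasCompactSupport (cG.mul cgW)
      (HasCompactSupport.intro hWc fun z hz => by
        simp [gradSq_eq_zero_of_notMem_tsupport hz])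
  have i3 : Integrable fun z => G z * ‖W z‖ ^ 2 := integrable_mul_norm_sq_of_continuous cG cW hWc
  have i4 : Integrable fun z => dt G z * ‖W z‖ ^ 2 :=
    integrable_mul_norm_sq_of_continuous cdtG cW hWc
  have i5 : Integrable fun z => lap G z * ‖W z‖ ^ 2 :=
    integrable_mul_norm_sq_of_continuous clapG cW hWc
  -- integrate the pointwise inequality
  have hI : -(c + c ^ 2 / 4) * ∫ z, G z * ‖W z‖ ^ 2 ≤
      (∫ z, G z * ⟪W z, dt W z + lap W z⟫) + ∫ z, G z * gradSq W z := by
    rw [← integral_const_mul, ← integral_add i1 i2]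
    exact integral_mono (i3.const_mul _) (i1.add i2) hpt
  rw [integral_mul_inner_dt_add_lap hW hWc hG] at hI
  -- split the goal integral
  have hsplit : ∫ z, (dt G z - lap G z - (2 * c + c ^ 2 / 2) * G z) * ‖W z‖ ^ 2 =
      (∫ z, dt G z * ‖W z‖ ^ 2) - (∫ z, lap G z * ‖W z‖ ^ 2)
        - (2 * c + c ^ 2 / 2) * ∫ z, G z * ‖W z‖ ^ 2 := by
    have i45 : Integrable fun z => dt G z * ‖W z‖ ^ 2 - lap G z * ‖W z‖ ^ 2 := i4.sub i5
    have i3' : Integrable fun z => (2 * c + c ^ 2 / 2) * (G z * ‖W z‖ ^ 2) := i3.const_mul _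
    rw [← integral_sub i4 i5, ← integral_const_mul, ← integral_sub i45 i3']
    refine integral_congr_ae (Eventually.of_forall fun z => ?_)
    show _ = dt G z * ‖W z‖ ^ 2 - lap G z * ‖W z‖ ^ 2 - (2 * c + c ^ 2 / 2) * (G z * ‖W z‖ ^ 2)
    ring
  rw [hsplit]
  linarith [hI]

/-! ### Localisation: fields of class `C²` on an open set -/

omit [MeasurableSpace E] [BorelSpace E] [InnerProductSpace ℝ F] in
/-- If two fields agree near `z`, so do all the frame quantities `∂ₜ`, `∂ₑ`, `∂ₑ∂ₑ`, `Δₓ`,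
`|∇ₓ·|²` at `z`. [folklore] -/
theorem frame_eq_of_eventuallyEq {G' : Type*} [NormedAddCommGroup G'] [NormedSpace ℝ G']
    {W v : ℝ × E → G'} {z : ℝ × E} {O : Set (ℝ × E)} (hO : IsOpen O) (hz : z ∈ O)
    (h : ∀ y ∈ O, W y = v y) :
    dt W z = dt v z ∧ (∀ e, dx e W z = dx e v z) ∧ (∀ e, dx e (dx e W) z = dx e (dx e v) z) ∧
      lap W z = lap v z ∧ gradSq W z = gradSq v z := by
  have hev : ∀ y ∈ O, W =ᶠ[𝓝 y] v := fun y hy => by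
    filter_upwards [hO.mem_nhds hy] with y' hy'
    exact h y' hy'
  have hfd : ∀ y ∈ O, fderiv ℝ W y = fderiv ℝ v y := fun y hy => (hev y hy).fderiv_eq
  have hdx : ∀ e, ∀ y ∈ O, dx e W y = dx e v y := fun e y hy => by
    rw [dx_apply, dx_apply, hfd y hy]
  have hdxev : ∀ e, dx e W =ᶠ[𝓝 z] dx e v := fun e => by
    filter_upwards [hO.mem_nhds hz] with y hy
    exact hdx e y hy
  have hdxdx : ∀ e, dx e (dx e W) z = dx e (dx e v) z := fun e => by
    rw [dx_apply, dx_apply, (hdxev e).fderiv_eq]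
  refine ⟨by rw [dt_apply, dt_apply, hfd z hz], fun e => hdx e z hz, hdxdx, ?_, ?_⟩
  · simp only [lap, hdxdx]
  · simp only [gradSq, hdx _ z hz]

/-- **Weak subsolution inequality** for the backward heat inequality. Let `U ⊆ ℝ × E` be open,
`v ∈ C²(U; F)` with `|∂ₜv + Δₓv| ≤ c₁ (|∇ₓv| + |v|)` on `U`, and let `G ≥ 0` be `C²` with compact
support, `tsupport G ⊆ U`. Then

  `∫ (∂ₜG - ΔₓG - (2c₁ + c₁²/2) G) |v|² ≤ 0`,

i.e. `|v|²` is a weak subsolution of `∂ₜw + Δw + (2c₁ + c₁²/2) w ≥ 0` (for `c₁ ≥ 0`; the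
statement holds for every real `c₁`). Proof: multiply `v` by a smooth cut-off `χ ∈ C_c^∞(U)`
equal to `1` near `tsupport G` (`exists_smooth_cutoff_nhdsSet`) and apply the global form to
`W = χ • v`, which is `C²` on `ℝ × E` and agrees with `v`, together with all frame derivatives,
wherever `G`, `∂ₜG` or `ΔG` is non-zero. [folklore] -/
theorem integral_heatOp_mul_norm_sq_nonpos {U : Set (ℝ × E)} (hU : IsOpen U) {v : ℝ × E → F}
    (hv : ContDiffOn ℝ 2 v U) {c₁ : ℝ}
    (hineq : ∀ z ∈ U, ‖dt v z + lap v z‖ ≤ c₁ * (Real.sqrt (gradSq v z) + ‖v z‖))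
    {G : ℝ × E → ℝ} (hG : ContDiff ℝ 2 G) (hGc : HasCompactSupport G) (hGU : tsupport G ⊆ U)
    (hG0 : ∀ z, 0 ≤ G z) :
    ∫ z, (dt G z - lap G z - (2 * c₁ + c₁ ^ 2 / 2) * G z) * ‖v z‖ ^ 2 ≤ 0 := by
  -- the cut-off and the open set where it equals `1`
  obtain ⟨χ, hχ, hχc, hχU, hχ1⟩ :=
    exists_smooth_cutoff_nhdsSet (X := ℝ × E) hGc hU hGU
  obtain ⟨O, hO, hKO, hO1⟩ := mem_nhdsSet_iff_exists.1 hχ1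
  have hχ2 : ContDiff ℝ 2 χ := hχ.of_le (WithTop.coe_le_coe.2 le_top)
  -- the globalised field
  set W : ℝ × E → F := fun z => χ z • v z with hWdef
  have hWU : ContDiffOn ℝ 2 W U := hχ2.contDiffOn.smul hv
  have hW : ContDiff ℝ 2 W :=
    contDiff_of_contDiffOn_of_eq_zero hU (isClosed_tsupport χ) hχU hWU fun z hz => by
      simp [hWdef, image_eq_zero_of_notMem_tsupport hz]
  have hWc : HasCompactSupport W := hχc.mono fun z hz => by
    contrapose! hz
    simp [hWdef, notMem_support.1 hz]
  have hWv : ∀ y ∈ O, W y = v y := fun y hy => by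
    have : χ y = 1 := hO1 hy
    simp [hWdef, this]
  -- off `O` the weight and its derivatives vanish
  have hGO : ∀ z, z ∉ O → G z = 0 ∧ dt G z = 0 ∧ lap G z = 0 := by
    intro z hz
    have hzK : z ∉ tsupport G := fun h => hz (hKO h)
    refine ⟨image_eq_zero_of_notMem_tsupport hzK, ?_, ?_⟩
    · rw [dt_apply, fderiv_of_notMem_tsupport (𝕜 := ℝ) hzK]
      rfl
    · exact image_eq_zero_of_notMem_tsupport fun h => hzK (tsupport_lap_subset G h)
  -- the inequality for `W` where `G ≠ 0`
  have hineqW : ∀ z, G z ≠ 0 → ‖dt W z + lap W z‖ ≤ c₁ * (Real.sqrt (gradSq W z) + ‖W z‖) := by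
    intro z hz
    have hzO : z ∈ O := by
      by_contra h
      exact hz (hGO z h).1
    obtain ⟨h1, -, -, h4, h5⟩ := frame_eq_of_eventuallyEq hO hzO hWv
    rw [h1, h4, h5, hWv z hzO]
    exact hineq z (hGU (subset_tsupport G (mem_support.2 hz)))
  -- the global inequality for `W`, and back to `v`
  have key := integral_heatOp_mul_norm_sq_nonpos_of_global hW hWc hG hG0 hineqW
  have heq : ∫ z, (dt G z - lap G z - (2 * c₁ + c₁ ^ 2 / 2) * G z) * ‖v z‖ ^ 2 =
      ∫ z, (dt G z - lap G z - (2 * c₁ + c₁ ^ 2 / 2) * G z) * ‖W z‖ ^ 2 := by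
    refine integral_congr_ae (Eventually.of_forall fun z => ?_)
    by_cases hzO : z ∈ O
    · simp only [hWv z hzO]
    · obtain ⟨h0, h1, h2⟩ := hGO z hzO
      simp only [h0, h1, h2, mul_zero, sub_zero, zero_mul]
  rw [heq]
  exact key

end Duality

end Carleman

end Literature.Analysis.FluidPDE
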